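import Summits.BirchSwinnertonDyer.Rank1Residual.X5.TwoAdicInstancesMultAnchorsA
import HarnessLib

/-!
# X5 at `p = 2` (cell `bsd-2adic`, seat `bsd-2adic-mult`, GEN 3): the SPLIT ANCHOR references of door
# (34-GV-mult) — 42a1, 138c1, 858i1, 3018d1

HONEST FRAMING (cell `bsd-2adic`, run/shared/lean/pub/bsd-2adic/, D-0036 / D-0054; memo
`HOME/mult/PROOF-GVMULT.md` + ADDENDA): every anchor `A` here is a Cremona curve with `2 ‖ N_A`, SPLIT
multiplicative at `2`, squarefree conductor with `LAW(N_A) = 1`, negative discriminant and ONE rational point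
of order `2` (integral abscissa, type B = a Prop-5.14 point); its cyclotomic invariants `(torsion, μ = 0,
λ = 0)` come from GEN-2's `anchor_invariants_of_prop514_split` given the displayed K11b-Rat at `A`, `hper₀`
and the certificates `λ_an(A) = 1` (only the trivial zero), `μ_an(A) = 0` (STEP-0 GVM kit j244761:
`(μ, λ)_an = (0, 1)` at 42a, 138c, 858i, 3018d). This file only DECIDES THE CURVE DATA (SPLIT reduction at `2`:
the node quadratic has a root in `𝔽₂`, tree criterion
`hasSplitMultiplicativeReductionAtPrime_iff_splits_integralModelInt`). Nothing booked.
References: [SilvermanAEC2009] VII.1.1, VII.5.1, VII.3.1; [Silverman1994] IV.10.2; [CremonaAlgorithms1997] Table 1.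
-/

set_option autoImplicit false

open IsDedekindDomain WeierstrassCurve Literature.NumberTheory.EllipticCurves
  Literature.NumberTheory.EllipticCurves.ModularForms
  Literature.NumberTheory.EllipticCurves.Rank1Residual
  Literature.NumberTheory.EllipticCurves.Rank1Residual.Typed
  Literature.NumberTheory.EllipticCurves.Greenberg1999
  Literature.NumberTheory.EllipticCurves.PolyCert
  Literature.NumberTheory.EllipticCurves.Rank1Residual.X11RankOneCertificates
  Summit.BirchSwinnertonDyer.Rank1Residual.X1.MuPart
  Summit.BirchSwinnertonDyer.Rank1Residual.X1.ParitySqueeze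
  Summit.BirchSwinnertonDyer.Rank1Residual.X5.O1

open CongruenceSubgroup
open scoped MatrixGroups ModularForm

namespace Summit.BirchSwinnertonDyer.Rank1Residual.X5.Instances

/-- A quadratic `aX² + bX + c` over `𝔽₂` (`a ≠ 0`) with a root `x ∈ 𝔽₂` splits (node-tangent quadratic of a
SPLIT multiplicative reduction, Silverman VII.5.1(b)). [folklore] -/
theorem splits_quadratic_F2_of_root {a b c : ZMod 2} (ha : a ≠ 0) (x : ZMod 2) (hx : a * x ^ 2 + b * x + c = 0) :
    (Polynomial.C a * Polynomial.X ^ 2 + Polynomial.C b * Polynomial.X + Polynomial.C c).Splits :=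
  Polynomial.Splits.of_natDegree_eq_two (x := x) (Polynomial.natDegree_quadratic ha)
    (by simpa [Polynomial.eval_add, Polynomial.eval_mul, Polynomial.eval_pow, Polynomial.eval_C,
      Polynomial.eval_X] using hx)

/-- Cremona `42a1` = `[1, 1, 1, -4, 5]` (integer model). [cite: CremonaAlgorithms1997, Table 1] -/
abbrev M42a1 : WeierstrassCurve ℤ := ⟨1, 1, 1, -4, 5⟩
/-- `42a1 / ℚ`. [cite: CremonaAlgorithms1997, Table 1] -/
abbrev c42a1 : WeierstrassCurve ℚ := M42a1.baseChange ℚ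
/-- `Δ(42a1)` (factorisation `{2: 8, 3: 2, 7: 1}`, negative). [cite: CremonaAlgorithms1997, Table 1] -/
theorem M42a1_Δ : M42a1.Δ = -16128 := by decide
/-- `c₄(42a1)` (coprime to `Δ`: semistable model). [cite: CremonaAlgorithms1997, Table 1] -/
theorem M42a1_c₄ : M42a1.c₄ = 193 := by decide
/-- `42a1` is an elliptic curve. [cite: CremonaAlgorithms1997, Table 1] -/
instance c42a1_isElliptic : c42a1.IsElliptic := by
  rw [WeierstrassCurve.isElliptic_iff, baseChange_int_Δ, M42a1_Δ]; norm_num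
/-- Cremona's model `42a1` is globally minimal (`gcd(Δ, c₄) = 1`). [cite: SilvermanAEC2009, VII.1 Remark 1.1] -/
instance c42a1_isGloballyMinimal : c42a1.IsGloballyMinimal :=
  isGloballyMinimal_baseChange_int_of_gcd_eq_one 1 1 1 (-4) 5 (by decide)
/-- `Δ(42a1)`, `c₄(42a1)` coprime. [cite: SilvermanAEC2009, VII.5 Prop. 5.1(b)] -/
theorem M42a1_coprime : IsCoprime M42a1.Δ M42a1.c₄ := by
  rw [M42a1_Δ, M42a1_c₄, Int.isCoprime_iff_gcd_eq_one]; decide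
/-- **`42a1` is multiplicative at `2`** (`2 ∣ Δ`, `2 ∤ c₄`). [cite: SilvermanAEC2009, VII.5 Prop. 5.1(b)] -/
theorem mult_two_42a1 : Mult c42a1 2 := by
  have hgen : Rat.HeightOneSpectrum.natGenerator
      ((Rat.HeightOneSpectrum.primesEquiv (R := ℤ)).symm ⟨2, Nat.prime_two⟩) = 2 :=
    Literature.NumberTheory.EllipticCurves.Rat.natGenerator_primesEquiv_symm ⟨2, Nat.prime_two⟩
  have hm := hasMultiplicativeReductionAt_baseChange_int_of_isCoprime M42a1 M42a1_coprime
    (v := (Rat.HeightOneSpectrum.primesEquiv (R := ℤ)).symm ⟨2, Nat.prime_two⟩)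
    (by rw [hgen, M42a1_Δ]; decide)
  exact (hasMultiplicativeReductionAtPrime_iff_hasMultiplicativeReductionAt_holds c42a1
    ⟨2, Nat.prime_two⟩).mpr hm
/-- `42a1 mod 2`. [folklore] -/
theorem M42a1_mod_two : M42a1.map (Int.castRingHom (ZMod 2)) = ⟨1, 1, 1, 0, 1⟩ := by
  ext <;> decide
/-- **`42a1` is SPLIT multiplicative at `2`** (the node quadratic has the root `0` in `𝔽₂`).
[cite: SilvermanAEC2009, VII.5 Prop. 5.1(b)] -/
theorem split_two_42a1 : c42a1.HasSplitMultiplicativeReductionAtPrime 2 := by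
  have hint : integralModelInt c42a1 = M42a1 := integralModelInt_baseChange_int M42a1
  have hΔ : ((2 : ℕ) : ℤ) ∣ (integralModelInt c42a1).Δ := by rw [hint, M42a1_Δ]; decide
  have hc₄ : ¬ ((2 : ℕ) : ℤ) ∣ (integralModelInt c42a1).c₄ := by rw [hint, M42a1_c₄]; decide
  rw [LocalTorsionMult.hasSplitMultiplicativeReductionAtPrime_iff_splits_integralModelInt c42a1 2 hΔ
    hc₄, hint, M42a1_mod_two]
  dsimp only
  rw [sub_eq_add_neg, ← Polynomial.C_neg]
  exact splits_quadratic_F2_of_root (by decide) 0 (by decide)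
/-- **The conductor of `42a1` is `42`** (semistable; Silverman ATAEC IV.10.2). [cite: CremonaAlgorithms1997, Table 1] -/
theorem conductorNorm_42a1 : c42a1.conductorNorm ℤ = 42 := by
  refine conductorNorm_baseChange_int_of_isCoprime M42a1 M42a1_coprime (k := 8) ?_ ?_ ?_
  · rw [Nat.squarefree_iff_nodup_primeFactorsList (by norm_num)]; simp
  · rw [M42a1_Δ]; decide
  · rw [M42a1_Δ]; decide
/-- The coefficients of `42a1 / ℚ` (unfolded). [cite: CremonaAlgorithms1997, Table 1] -/
theorem c42a1_eq : c42a1 = ⟨1, 1, 1, -4, 5⟩ := by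
  rw [c42a1, baseChange_int_eq]; norm_num
/-- `b₂, b₄, b₆` of `42a1`; `2`-division cubic `= (x − (-3))(4x² + (-7)x + (7))`. [cite: SilvermanAEC2009, III.1] -/
theorem c42a1_b : c42a1.b₂ = 5 ∧ c42a1.b₄ = -7 ∧ c42a1.b₆ = 21 := by
  rw [c42a1_eq]
  simp only [WeierstrassCurve.b₂, WeierstrassCurve.b₄, WeierstrassCurve.b₆]
  norm_num
/-- The rational point `(-3, 1)` of order `2` on `42a1`. [cite: CremonaAlgorithms1997, Table 1] -/
theorem c42a1_P : c42a1.toAffine.Equation (-3) 1 ∧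
    2 * (1 : ℚ) + c42a1.a₁ * (-3) + c42a1.a₃ = 0 := by
  rw [c42a1_eq, WeierstrassCurve.Affine.equation_iff]; norm_num
/-- **`(-3, 1)` is the ONLY rational point of order `2` on `42a1`** (cofactor of negative discriminant).
[cite: SilvermanAEC2009, III.2.3] -/
theorem c42a1_unique : HasUniqueRationalTwoTorsionX c42a1 (-3) := by
  refine ⟨⟨1, c42a1_P⟩, fun z hz ↦ ?_⟩
  have hc := cubic_eq_zero_of_hasRationalTwoTorsionX hz
  obtain ⟨hb₂, hb₄, hb₆⟩ := c42a1_b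
  rw [hb₂, hb₄, hb₆] at hc
  have hfac : (z - (-3)) * (4 * z ^ 2 + (-7) * z + 7) = 0 := by linear_combination hc
  rcases mul_eq_zero.mp hfac with h | h
  · linarith
  · nlinarith [sq_nonneg (8 * z + (-7))]
/-- **`(-3, 1)` is "odd"**: the only real root of the `2`-division cubic. [cite: GreenbergLNM1716, §5 Remark (chunk p0174)] -/
theorem c42a1_odd : TwoTorsionOdd c42a1 (-3) := by
  intro r hr
  obtain ⟨hb₂, hb₄, hb₆⟩ := c42a1_b
  rw [hb₂, hb₄, hb₆] at hr
  push_cast at hr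
  have hfac : (r - (-3)) * (4 * r ^ 2 + (-7) * r + 7) = 0 := by linear_combination hr
  rcases mul_eq_zero.mp hfac with h | h
  · push_cast; linarith
  · nlinarith [sq_nonneg (8 * r + (-7))]
/-- `2 ∣ #Ẽ(𝔽_ℓ)` for `42a1` at every good odd prime `ℓ` (a rational `2`-torsion point). [cite: SilvermanAEC2009, VII.3.1(b)] -/
theorem two_dvd_reductionPointCount_42a1 {ℓ : ℕ} [Fact ℓ.Prime] (hℓ : 3 ≤ ℓ)
    (hΔ : ¬ (ℓ : ℤ) ∣ (-16128 : ℤ)) : 2 ∣ c42a1.reductionPointCount ℓ :=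
  two_dvd_reductionPointCount_of_hasRationalTwoTorsionX ⟨1, c42a1_P⟩ hℓ
    (by rw [minimalDiscriminantInt_baseChange_int, M42a1_Δ]; exact hΔ)

/-- Cremona `138c1` = `[1, 1, 1, 3, 3]` (integer model). [cite: CremonaAlgorithms1997, Table 1] -/
abbrev M138c1 : WeierstrassCurve ℤ := ⟨1, 1, 1, 3, 3⟩
/-- `138c1 / ℚ`. [cite: CremonaAlgorithms1997, Table 1] -/
abbrev c138c1 : WeierstrassCurve ℚ := M138c1.baseChange ℚ
/-- `Δ(138c1)` (factorisation `{2: 4, 3: 2, 23: 1}`, negative). [cite: CremonaAlgorithms1997, Table 1] -/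
theorem M138c1_Δ : M138c1.Δ = -3312 := by decide
/-- `c₄(138c1)` (coprime to `Δ`: semistable model). [cite: CremonaAlgorithms1997, Table 1] -/
theorem M138c1_c₄ : M138c1.c₄ = -143 := by decide
/-- `138c1` is an elliptic curve. [cite: CremonaAlgorithms1997, Table 1] -/
instance c138c1_isElliptic : c138c1.IsElliptic := by
  rw [WeierstrassCurve.isElliptic_iff, baseChange_int_Δ, M138c1_Δ]; norm_num
/-- Cremona's model `138c1` is globally minimal (`gcd(Δ, c₄) = 1`). [cite: SilvermanAEC2009, VII.1 Remark 1.1] -/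
instance c138c1_isGloballyMinimal : c138c1.IsGloballyMinimal :=
  isGloballyMinimal_baseChange_int_of_gcd_eq_one 1 1 1 3 3 (by decide)
/-- `Δ(138c1)`, `c₄(138c1)` coprime. [cite: SilvermanAEC2009, VII.5 Prop. 5.1(b)] -/
theorem M138c1_coprime : IsCoprime M138c1.Δ M138c1.c₄ := by
  rw [M138c1_Δ, M138c1_c₄, Int.isCoprime_iff_gcd_eq_one]; decide
/-- **`138c1` is multiplicative at `2`** (`2 ∣ Δ`, `2 ∤ c₄`). [cite: SilvermanAEC2009, VII.5 Prop. 5.1(b)] -/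
theorem mult_two_138c1 : Mult c138c1 2 := by
  have hgen : Rat.HeightOneSpectrum.natGenerator
      ((Rat.HeightOneSpectrum.primesEquiv (R := ℤ)).symm ⟨2, Nat.prime_two⟩) = 2 :=
    Literature.NumberTheory.EllipticCurves.Rat.natGenerator_primesEquiv_symm ⟨2, Nat.prime_two⟩
  have hm := hasMultiplicativeReductionAt_baseChange_int_of_isCoprime M138c1 M138c1_coprime
    (v := (Rat.HeightOneSpectrum.primesEquiv (R := ℤ)).symm ⟨2, Nat.prime_two⟩)
    (by rw [hgen, M138c1_Δ]; decide)
  exact (hasMultiplicativeReductionAtPrime_iff_hasMultiplicativeReductionAt_holds c138c1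
    ⟨2, Nat.prime_two⟩).mpr hm
/-- `138c1 mod 2`. [folklore] -/
theorem M138c1_mod_two : M138c1.map (Int.castRingHom (ZMod 2)) = ⟨1, 1, 1, 1, 1⟩ := by
  ext <;> decide
/-- **`138c1` is SPLIT multiplicative at `2`** (the node quadratic has the root `0` in `𝔽₂`).
[cite: SilvermanAEC2009, VII.5 Prop. 5.1(b)] -/
theorem split_two_138c1 : c138c1.HasSplitMultiplicativeReductionAtPrime 2 := by
  have hint : integralModelInt c138c1 = M138c1 := integralModelInt_baseChange_int M138c1
  have hΔ : ((2 : ℕ) : ℤ) ∣ (integralModelInt c138c1).Δ := by rw [hint, M138c1_Δ]; decide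
  have hc₄ : ¬ ((2 : ℕ) : ℤ) ∣ (integralModelInt c138c1).c₄ := by rw [hint, M138c1_c₄]; decide
  rw [LocalTorsionMult.hasSplitMultiplicativeReductionAtPrime_iff_splits_integralModelInt c138c1 2 hΔ
    hc₄, hint, M138c1_mod_two]
  dsimp only
  rw [sub_eq_add_neg, ← Polynomial.C_neg]
  exact splits_quadratic_F2_of_root (by decide) 0 (by decide)
/-- **The conductor of `138c1` is `138`** (semistable; Silverman ATAEC IV.10.2). [cite: CremonaAlgorithms1997, Table 1] -/
theorem conductorNorm_138c1 : c138c1.conductorNorm ℤ = 138 := by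
  refine conductorNorm_baseChange_int_of_isCoprime M138c1 M138c1_coprime (k := 4) ?_ ?_ ?_
  · rw [Nat.squarefree_iff_nodup_primeFactorsList (by norm_num)]; simp
  · rw [M138c1_Δ]; decide
  · rw [M138c1_Δ]; decide
/-- The coefficients of `138c1 / ℚ` (unfolded). [cite: CremonaAlgorithms1997, Table 1] -/
theorem c138c1_eq : c138c1 = ⟨1, 1, 1, 3, 3⟩ := by
  rw [c138c1, baseChange_int_eq]; norm_num
/-- `b₂, b₄, b₆` of `138c1`; `2`-division cubic `= (x − (-1))(4x² + (1)x + (13))`. [cite: SilvermanAEC2009, III.1] -/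
theorem c138c1_b : c138c1.b₂ = 5 ∧ c138c1.b₄ = 7 ∧ c138c1.b₆ = 13 := by
  rw [c138c1_eq]
  simp only [WeierstrassCurve.b₂, WeierstrassCurve.b₄, WeierstrassCurve.b₆]
  norm_num
/-- The rational point `(-1, 0)` of order `2` on `138c1`. [cite: CremonaAlgorithms1997, Table 1] -/
theorem c138c1_P : c138c1.toAffine.Equation (-1) 0 ∧
    2 * (0 : ℚ) + c138c1.a₁ * (-1) + c138c1.a₃ = 0 := by
  rw [c138c1_eq, WeierstrassCurve.Affine.equation_iff]; norm_num
/-- **`(-1, 0)` is the ONLY rational point of order `2` on `138c1`** (cofactor of negative discriminant).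
[cite: SilvermanAEC2009, III.2.3] -/
theorem c138c1_unique : HasUniqueRationalTwoTorsionX c138c1 (-1) := by
  refine ⟨⟨0, c138c1_P⟩, fun z hz ↦ ?_⟩
  have hc := cubic_eq_zero_of_hasRationalTwoTorsionX hz
  obtain ⟨hb₂, hb₄, hb₆⟩ := c138c1_b
  rw [hb₂, hb₄, hb₆] at hc
  have hfac : (z - (-1)) * (4 * z ^ 2 + 1 * z + 13) = 0 := by linear_combination hc
  rcases mul_eq_zero.mp hfac with h | h
  · linarith
  · nlinarith [sq_nonneg (8 * z + 1)]
/-- **`(-1, 0)` is "odd"**: the only real root of the `2`-division cubic. [cite: GreenbergLNM1716, §5 Remark (chunk p0174)] -/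
theorem c138c1_odd : TwoTorsionOdd c138c1 (-1) := by
  intro r hr
  obtain ⟨hb₂, hb₄, hb₆⟩ := c138c1_b
  rw [hb₂, hb₄, hb₆] at hr
  push_cast at hr
  have hfac : (r - (-1)) * (4 * r ^ 2 + 1 * r + 13) = 0 := by linear_combination hr
  rcases mul_eq_zero.mp hfac with h | h
  · push_cast; linarith
  · nlinarith [sq_nonneg (8 * r + 1)]
/-- `2 ∣ #Ẽ(𝔽_ℓ)` for `138c1` at every good odd prime `ℓ` (a rational `2`-torsion point). [cite: SilvermanAEC2009, VII.3.1(b)] -/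
theorem two_dvd_reductionPointCount_138c1 {ℓ : ℕ} [Fact ℓ.Prime] (hℓ : 3 ≤ ℓ)
    (hΔ : ¬ (ℓ : ℤ) ∣ (-3312 : ℤ)) : 2 ∣ c138c1.reductionPointCount ℓ :=
  two_dvd_reductionPointCount_of_hasRationalTwoTorsionX ⟨0, c138c1_P⟩ hℓ
    (by rw [minimalDiscriminantInt_baseChange_int, M138c1_Δ]; exact hΔ)

/-- Cremona `858i1` = `[1, 1, 1, -2301, -43629]` (integer model). [cite: CremonaAlgorithms1997, Table 1] -/
abbrev M858i1 : WeierstrassCurve ℤ := ⟨1, 1, 1, -2301, -43629⟩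
/-- `858i1 / ℚ`. [cite: CremonaAlgorithms1997, Table 1] -/
abbrev c858i1 : WeierstrassCurve ℚ := M858i1.baseChange ℚ
/-- `Δ(858i1)` (factorisation `{2: 16, 3: 6, 11: 1, 13: 1}`, negative). [cite: CremonaAlgorithms1997, Table 1] -/
theorem M858i1_Δ : M858i1.Δ = -6831931392 := by decide
/-- `c₄(858i1)` (coprime to `Δ`: semistable model). [cite: CremonaAlgorithms1997, Table 1] -/
theorem M858i1_c₄ : M858i1.c₄ = 110449 := by decide
/-- `858i1` is an elliptic curve. [cite: CremonaAlgorithms1997, Table 1] -/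
instance c858i1_isElliptic : c858i1.IsElliptic := by
  rw [WeierstrassCurve.isElliptic_iff, baseChange_int_Δ, M858i1_Δ]; norm_num
/-- Cremona's model `858i1` is globally minimal (`gcd(Δ, c₄) = 1`). [cite: SilvermanAEC2009, VII.1 Remark 1.1] -/
instance c858i1_isGloballyMinimal : c858i1.IsGloballyMinimal :=
  isGloballyMinimal_baseChange_int_of_gcd_eq_one 1 1 1 (-2301) (-43629) (by decide)
/-- `Δ(858i1)`, `c₄(858i1)` coprime. [cite: SilvermanAEC2009, VII.5 Prop. 5.1(b)] -/
theorem M858i1_coprime : IsCoprime M858i1.Δ M858i1.c₄ := by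
  rw [M858i1_Δ, M858i1_c₄, Int.isCoprime_iff_gcd_eq_one]; decide
/-- **`858i1` is multiplicative at `2`** (`2 ∣ Δ`, `2 ∤ c₄`). [cite: SilvermanAEC2009, VII.5 Prop. 5.1(b)] -/
theorem mult_two_858i1 : Mult c858i1 2 := by
  have hgen : Rat.HeightOneSpectrum.natGenerator
      ((Rat.HeightOneSpectrum.primesEquiv (R := ℤ)).symm ⟨2, Nat.prime_two⟩) = 2 :=
    Literature.NumberTheory.EllipticCurves.Rat.natGenerator_primesEquiv_symm ⟨2, Nat.prime_two⟩
  have hm := hasMultiplicativeReductionAt_baseChange_int_of_isCoprime M858i1 M858i1_coprime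
    (v := (Rat.HeightOneSpectrum.primesEquiv (R := ℤ)).symm ⟨2, Nat.prime_two⟩)
    (by rw [hgen, M858i1_Δ]; decide)
  exact (hasMultiplicativeReductionAtPrime_iff_hasMultiplicativeReductionAt_holds c858i1
    ⟨2, Nat.prime_two⟩).mpr hm
/-- `858i1 mod 2`. [folklore] -/
theorem M858i1_mod_two : M858i1.map (Int.castRingHom (ZMod 2)) = ⟨1, 1, 1, 1, 1⟩ := by
  ext <;> decide
/-- **`858i1` is SPLIT multiplicative at `2`** (the node quadratic has the root `0` in `𝔽₂`).
[cite: SilvermanAEC2009, VII.5 Prop. 5.1(b)] -/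
theorem split_two_858i1 : c858i1.HasSplitMultiplicativeReductionAtPrime 2 := by
  have hint : integralModelInt c858i1 = M858i1 := integralModelInt_baseChange_int M858i1
  have hΔ : ((2 : ℕ) : ℤ) ∣ (integralModelInt c858i1).Δ := by rw [hint, M858i1_Δ]; decide
  have hc₄ : ¬ ((2 : ℕ) : ℤ) ∣ (integralModelInt c858i1).c₄ := by rw [hint, M858i1_c₄]; decide
  rw [LocalTorsionMult.hasSplitMultiplicativeReductionAtPrime_iff_splits_integralModelInt c858i1 2 hΔ
    hc₄, hint, M858i1_mod_two]
  dsimp only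
  rw [sub_eq_add_neg, ← Polynomial.C_neg]
  exact splits_quadratic_F2_of_root (by decide) 0 (by decide)
/-- **The conductor of `858i1` is `858`** (semistable; Silverman ATAEC IV.10.2). [cite: CremonaAlgorithms1997, Table 1] -/
theorem conductorNorm_858i1 : c858i1.conductorNorm ℤ = 858 := by
  refine conductorNorm_baseChange_int_of_isCoprime M858i1 M858i1_coprime (k := 16) ?_ ?_ ?_
  · rw [Nat.squarefree_iff_nodup_primeFactorsList (by norm_num)]; simp
  · rw [M858i1_Δ]; decide
  · rw [M858i1_Δ]; decide
/-- The coefficients of `858i1 / ℚ` (unfolded). [cite: CremonaAlgorithms1997, Table 1] -/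
theorem c858i1_eq : c858i1 = ⟨1, 1, 1, -2301, -43629⟩ := by
  rw [c858i1, baseChange_int_eq]; norm_num
/-- `b₂, b₄, b₆` of `858i1`; `2`-division cubic `= (x − (55))(4x² + (225)x + (3173))`. [cite: SilvermanAEC2009, III.1] -/
theorem c858i1_b : c858i1.b₂ = 5 ∧ c858i1.b₄ = -4601 ∧ c858i1.b₆ = -174515 := by
  rw [c858i1_eq]
  simp only [WeierstrassCurve.b₂, WeierstrassCurve.b₄, WeierstrassCurve.b₆]
  norm_num
/-- The rational point `(55, -28)` of order `2` on `858i1`. [cite: CremonaAlgorithms1997, Table 1] -/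
theorem c858i1_P : c858i1.toAffine.Equation 55 (-28) ∧
    2 * ((-28) : ℚ) + c858i1.a₁ * 55 + c858i1.a₃ = 0 := by
  rw [c858i1_eq, WeierstrassCurve.Affine.equation_iff]; norm_num
/-- **`(55, -28)` is the ONLY rational point of order `2` on `858i1`** (cofactor of negative discriminant).
[cite: SilvermanAEC2009, III.2.3] -/
theorem c858i1_unique : HasUniqueRationalTwoTorsionX c858i1 55 := by
  refine ⟨⟨(-28), c858i1_P⟩, fun z hz ↦ ?_⟩
  have hc := cubic_eq_zero_of_hasRationalTwoTorsionX hz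
  obtain ⟨hb₂, hb₄, hb₆⟩ := c858i1_b
  rw [hb₂, hb₄, hb₆] at hc
  have hfac : (z - 55) * (4 * z ^ 2 + 225 * z + 3173) = 0 := by linear_combination hc
  rcases mul_eq_zero.mp hfac with h | h
  · linarith
  · nlinarith [sq_nonneg (8 * z + 225)]
/-- **`(55, -28)` is "odd"**: the only real root of the `2`-division cubic. [cite: GreenbergLNM1716, §5 Remark (chunk p0174)] -/
theorem c858i1_odd : TwoTorsionOdd c858i1 55 := by
  intro r hr
  obtain ⟨hb₂, hb₄, hb₆⟩ := c858i1_b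
  rw [hb₂, hb₄, hb₆] at hr
  push_cast at hr
  have hfac : (r - 55) * (4 * r ^ 2 + 225 * r + 3173) = 0 := by linear_combination hr
  rcases mul_eq_zero.mp hfac with h | h
  · push_cast; linarith
  · nlinarith [sq_nonneg (8 * r + 225)]
/-- `2 ∣ #Ẽ(𝔽_ℓ)` for `858i1` at every good odd prime `ℓ` (a rational `2`-torsion point). [cite: SilvermanAEC2009, VII.3.1(b)] -/
theorem two_dvd_reductionPointCount_858i1 {ℓ : ℕ} [Fact ℓ.Prime] (hℓ : 3 ≤ ℓ)
    (hΔ : ¬ (ℓ : ℤ) ∣ (-6831931392 : ℤ)) : 2 ∣ c858i1.reductionPointCount ℓ :=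
  two_dvd_reductionPointCount_of_hasRationalTwoTorsionX ⟨(-28), c858i1_P⟩ hℓ
    (by rw [minimalDiscriminantInt_baseChange_int, M858i1_Δ]; exact hΔ)

/-- Cremona `3018d1` = `[1, 1, 1, -247, 3533]` (integer model). [cite: CremonaAlgorithms1997, Table 1] -/
abbrev M3018d1 : WeierstrassCurve ℤ := ⟨1, 1, 1, -247, 3533⟩
/-- `3018d1 / ℚ`. [cite: CremonaAlgorithms1997, Table 1] -/
abbrev c3018d1 : WeierstrassCurve ℚ := M3018d1.baseChange ℚ
/-- `Δ(3018d1)` (factorisation `{2: 20, 3: 2, 503: 1}`, negative). [cite: CremonaAlgorithms1997, Table 1] -/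
theorem M3018d1_Δ : M3018d1.Δ = -4746903552 := by decide
/-- `c₄(3018d1)` (coprime to `Δ`: semistable model). [cite: CremonaAlgorithms1997, Table 1] -/
theorem M3018d1_c₄ : M3018d1.c₄ = 11857 := by decide
/-- `3018d1` is an elliptic curve. [cite: CremonaAlgorithms1997, Table 1] -/
instance c3018d1_isElliptic : c3018d1.IsElliptic := by
  rw [WeierstrassCurve.isElliptic_iff, baseChange_int_Δ, M3018d1_Δ]; norm_num
/-- Cremona's model `3018d1` is globally minimal (`gcd(Δ, c₄) = 1`). [cite: SilvermanAEC2009, VII.1 Remark 1.1] -/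
instance c3018d1_isGloballyMinimal : c3018d1.IsGloballyMinimal :=
  isGloballyMinimal_baseChange_int_of_gcd_eq_one 1 1 1 (-247) 3533 (by decide)
/-- `Δ(3018d1)`, `c₄(3018d1)` coprime. [cite: SilvermanAEC2009, VII.5 Prop. 5.1(b)] -/
theorem M3018d1_coprime : IsCoprime M3018d1.Δ M3018d1.c₄ := by
  rw [M3018d1_Δ, M3018d1_c₄, Int.isCoprime_iff_gcd_eq_one]; decide
/-- **`3018d1` is multiplicative at `2`** (`2 ∣ Δ`, `2 ∤ c₄`). [cite: SilvermanAEC2009, VII.5 Prop. 5.1(b)] -/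
theorem mult_two_3018d1 : Mult c3018d1 2 := by
  have hgen : Rat.HeightOneSpectrum.natGenerator
      ((Rat.HeightOneSpectrum.primesEquiv (R := ℤ)).symm ⟨2, Nat.prime_two⟩) = 2 :=
    Literature.NumberTheory.EllipticCurves.Rat.natGenerator_primesEquiv_symm ⟨2, Nat.prime_two⟩
  have hm := hasMultiplicativeReductionAt_baseChange_int_of_isCoprime M3018d1 M3018d1_coprime
    (v := (Rat.HeightOneSpectrum.primesEquiv (R := ℤ)).symm ⟨2, Nat.prime_two⟩)
    (by rw [hgen, M3018d1_Δ]; decide)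
  exact (hasMultiplicativeReductionAtPrime_iff_hasMultiplicativeReductionAt_holds c3018d1
    ⟨2, Nat.prime_two⟩).mpr hm
/-- `3018d1 mod 2`. [folklore] -/
theorem M3018d1_mod_two : M3018d1.map (Int.castRingHom (ZMod 2)) = ⟨1, 1, 1, 1, 1⟩ := by
  ext <;> decide
/-- **`3018d1` is SPLIT multiplicative at `2`** (the node quadratic has the root `0` in `𝔽₂`).
[cite: SilvermanAEC2009, VII.5 Prop. 5.1(b)] -/
theorem split_two_3018d1 : c3018d1.HasSplitMultiplicativeReductionAtPrime 2 := by
  have hint : integralModelInt c3018d1 = M3018d1 := integralModelInt_baseChange_int M3018d1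
  have hΔ : ((2 : ℕ) : ℤ) ∣ (integralModelInt c3018d1).Δ := by rw [hint, M3018d1_Δ]; decide
  have hc₄ : ¬ ((2 : ℕ) : ℤ) ∣ (integralModelInt c3018d1).c₄ := by rw [hint, M3018d1_c₄]; decide
  rw [LocalTorsionMult.hasSplitMultiplicativeReductionAtPrime_iff_splits_integralModelInt c3018d1 2 hΔ
    hc₄, hint, M3018d1_mod_two]
  dsimp only
  rw [sub_eq_add_neg, ← Polynomial.C_neg]
  exact splits_quadratic_F2_of_root (by decide) 0 (by decide)
/-- **The conductor of `3018d1` is `3018`** (semistable; Silverman ATAEC IV.10.2). [cite: CremonaAlgorithms1997, Table 1] -/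
theorem conductorNorm_3018d1 : c3018d1.conductorNorm ℤ = 3018 := by
  refine conductorNorm_baseChange_int_of_isCoprime M3018d1 M3018d1_coprime (k := 20) ?_ ?_ ?_
  · rw [Nat.squarefree_iff_nodup_primeFactorsList (by norm_num)]; simp
  · rw [M3018d1_Δ]; decide
  · rw [M3018d1_Δ]; decide
/-- The coefficients of `3018d1 / ℚ` (unfolded). [cite: CremonaAlgorithms1997, Table 1] -/
theorem c3018d1_eq : c3018d1 = ⟨1, 1, 1, -247, 3533⟩ := by
  rw [c3018d1, baseChange_int_eq]; norm_num
/-- `b₂, b₄, b₆` of `3018d1`; `2`-division cubic `= (x − (-21))(4x² + (-79)x + (673))`. [cite: SilvermanAEC2009, III.1] -/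
theorem c3018d1_b : c3018d1.b₂ = 5 ∧ c3018d1.b₄ = -493 ∧ c3018d1.b₆ = 14133 := by
  rw [c3018d1_eq]
  simp only [WeierstrassCurve.b₂, WeierstrassCurve.b₄, WeierstrassCurve.b₆]
  norm_num
/-- The rational point `(-21, 10)` of order `2` on `3018d1`. [cite: CremonaAlgorithms1997, Table 1] -/
theorem c3018d1_P : c3018d1.toAffine.Equation (-21) 10 ∧
    2 * (10 : ℚ) + c3018d1.a₁ * (-21) + c3018d1.a₃ = 0 := by
  rw [c3018d1_eq, WeierstrassCurve.Affine.equation_iff]; norm_num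
/-- **`(-21, 10)` is the ONLY rational point of order `2` on `3018d1`** (cofactor of negative discriminant).
[cite: SilvermanAEC2009, III.2.3] -/
theorem c3018d1_unique : HasUniqueRationalTwoTorsionX c3018d1 (-21) := by
  refine ⟨⟨10, c3018d1_P⟩, fun z hz ↦ ?_⟩
  have hc := cubic_eq_zero_of_hasRationalTwoTorsionX hz
  obtain ⟨hb₂, hb₄, hb₆⟩ := c3018d1_b
  rw [hb₂, hb₄, hb₆] at hc
  have hfac : (z - (-21)) * (4 * z ^ 2 + (-79) * z + 673) = 0 := by linear_combination hc
  rcases mul_eq_zero.mp hfac with h | h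
  · linarith
  · nlinarith [sq_nonneg (8 * z + (-79))]
/-- **`(-21, 10)` is "odd"**: the only real root of the `2`-division cubic. [cite: GreenbergLNM1716, §5 Remark (chunk p0174)] -/
theorem c3018d1_odd : TwoTorsionOdd c3018d1 (-21) := by
  intro r hr
  obtain ⟨hb₂, hb₄, hb₆⟩ := c3018d1_b
  rw [hb₂, hb₄, hb₆] at hr
  push_cast at hr
  have hfac : (r - (-21)) * (4 * r ^ 2 + (-79) * r + 673) = 0 := by linear_combination hr
  rcases mul_eq_zero.mp hfac with h | h
  · push_cast; linarith
  · nlinarith [sq_nonneg (8 * r + (-79))]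
/-- `2 ∣ #Ẽ(𝔽_ℓ)` for `3018d1` at every good odd prime `ℓ` (a rational `2`-torsion point). [cite: SilvermanAEC2009, VII.3.1(b)] -/
theorem two_dvd_reductionPointCount_3018d1 {ℓ : ℕ} [Fact ℓ.Prime] (hℓ : 3 ≤ ℓ)
    (hΔ : ¬ (ℓ : ℤ) ∣ (-4746903552 : ℤ)) : 2 ∣ c3018d1.reductionPointCount ℓ :=
  two_dvd_reductionPointCount_of_hasRationalTwoTorsionX ⟨10, c3018d1_P⟩ hℓ
    (by rw [minimalDiscriminantInt_baseChange_int, M3018d1_Δ]; exact hΔ)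

end Summit.BirchSwinnertonDyer.Rank1Residual.X5.Instances
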